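import Literature.NumberTheory.EllipticCurves.Gamma1PeriodLatticeTwistProofs
import Literature.NumberTheory.EllipticCurves.ModularSymbolsPeriodHomology
import Literature.NumberTheory.EllipticCurves.CuspFormTwistHecke
import HarnessLib

/-!
# The `χ_p`-twisting operator on the period homology `H₁(X₀(N), ℤ)` at level `p² ∣ N`

Route `TeichmullerTwistDescent` (D-0145 LINE 2); helper for the LINE-11 crux `TwistedPeriodLatticeSaturation`
(stmt-BirchSwinnertonDyer-25368, «K») — §1 (1a)–(1c) of the seat memo `MECHANISM-K-lattice.md`
(evidence on 25368 / 23885), the `X₀(p²M)`-side companion of the finite model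
`TeichmullerTwistDescentTwistOperatorFiniteModel.lean` (p693224).  No summit, rung or crux is proved
here; BSD is not proved by this file; K is not proved by this file.

## What

Let `p` be a prime with `p² ∣ N`, `χ` the primitive quadratic Dirichlet character mod `p`,
`g(χ) = gaussSum χ e_p` its Gauss sum, and `f ↦ f_χ := charTwist N _ _ _ f` the twist on `S₂(Γ₀(N))`
(`aₙ(f_χ) = χ(n)aₙ(f)`, tree `CuspFormTwist`).  The TWISTING OPERATOR of the memo is
`T_χ := Σ_{u mod p} χ(u)·[1 u/p; 0 1]_*` on `H₁(X₀(N), ℤ)`; on the tree's model of `H₁(X₀(N), ℤ)`, the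
period homology `Λ = periodHomology N ⊆ S₂(Γ₀(N))^∨` (period functionals `h ↦ {∞, γ∞}_h`), it is the
transpose of `f ↦ Σ_u χ(u) f∣[1 u/p;0 1] = g(χ)·f_χ`, i.e. `(T_χ φ)(f) = g(χ)·φ(f_χ)`.  THEOREMS ONLY (no
definition is introduced; `T_χ φ` is produced as an element `ψ` with `ψ(f) = g(χ)φ(f_χ)` for all `f`):

* `exists_gaussSum_mul_cuspSymbol_charTwist_eq_sum` — Shimura's matrices, UNIFORMLY in `f`: for every
  `γ ∈ Γ₀(N)` there are `γ'_u ∈ Γ₀(N)` (`u mod p`) with `g(χ)·{∞, γ∞}_{f_χ} = Σ_u χ(u)·{∞, γ'_u ∞}_f` for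
  ALL `f` (the tree's `gaussSum_mul_cuspSymbol_charTwist` + `exists_sl2_div_eq_div_add_twistShift`).
* `exists_twist_mem_periodHomology` — **`T_χ` preserves `H₁(X₀(N), ℤ)`**: for `φ ∈ Λ` there is `ψ ∈ Λ`
  with `ψ(f) = g(χ)·φ(f_χ)` for all `f` (= (1a): `T_χ[γ] = Σ_u χ(u)[γ'_u]`).
* `charTwist_charTwist_of_depleted`, `gaussSum_mul_gaussSum_mul_apply_charTwist_charTwist` —
  **`T_χ² = χ(−1)·p` on the `p`-depleted part** (= (1b): for `f` with `aₙ(f) = 0` whenever `p ∣ n` — every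
  newform of level `N`, `p² ∣ N` — `(f_χ)_χ = f` and `g(χ)² = χ(−1)p`, Mathlib `gaussSum_sq`).
* `twist_apply_heckeT_of_eigen` — **`T_χ` twists Hecke eigenvalues** (= the `S_V → S_W` clause of (1c)):
  if `φ(T_ℓ h) = a·φ(h)` for all `h` (`ℓ ∤ p` prime) then `ψ(T_ℓ h) = χ(ℓ)a·ψ(h)` (tree `heckeT_charTwist`).
* `periodMap_twist` — `ψ(f) = g(χ)·φ(f_χ)` read as `Per_f ∘ T_χ = g(χ)·Per_{f_χ}` on `Λ`, so that
  `T_χ` maps the `f_χ`-period lattice picture into the `f`-one: the source of the inclusion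
  `g(χ)Λ(f_χ) ⊆ Λ(f)` (tree `gaussSum_mul_mem_periodLattice_of_mem_charTwist`) whose EQUALITY is K.

Not here (no carrier): the adjointness `T_χ^† = χ(−1)T_χ` for the intersection pairing and the index
identity `i_W·j_W = p²` of the memo §1 (1d) — the tree has the intersection pairing on `Λ` only as the
named fact `periodHomology_exists_heckeSelfAdjoint_perfectPairing`.

References: G. Shimura, *Introduction to the arithmetic theory of automorphic functions* (1971), Prop.
3.64; G. Stevens, Invent. Math. 98 (1989), (5.4)–(5.5); J. E. Cremona, *Algorithms for modular elliptic
curves*, §2.1, §2.8 (twisted symbols); B. Mazur, J. Tate, J. Teitelbaum, Invent. Math. 84 (1986) §I.8.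
-/

noncomputable section

set_option linter.dupNamespace false

open scoped MatrixGroups ModularForm
open CongruenceSubgroup Matrix.SpecialLinearGroup
  Literature.NumberTheory.EllipticCurves.ModularForms Literature.NumberTheory.Automorphic

namespace Summit.BirchSwinnertonDyer.BirchSwinnertonDyer.Theorems.TeichmullerTwistDescent.TwistOperatorPeriodHomology

variable {N p : ℕ} [NeZero N] [hp : Fact p.Prime] (hpN : p ^ 2 ∣ N)
  {χ : DirichletCharacter ℂ p} (hχ : χ.IsQuadratic) (hprim : χ.IsPrimitive)

/-! ### Scalars `χ(u) ∈ {0, ±1}` act on subgroups -/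

omit hp in
/-- A value `χ(u) ∈ {0, 1, −1}` of a quadratic character times an element of an additive subgroup of
a `ℂ`-module stays in the subgroup. [folklore] -/
theorem chi_smul_mem {M : Type*} [AddCommGroup M] [Module ℂ M] (hχ : χ.IsQuadratic) (u : ZMod p)
    {Λ : AddSubgroup M} {x : M} (hx : x ∈ Λ) : χ u • x ∈ Λ := by
  rcases hχ u with h | h | h
  · rw [h, zero_smul]; exact zero_mem _
  · rw [h, one_smul]; exact hx
  · rw [h, neg_smul, one_smul]; exact neg_mem hx

/-! ### Shimura's matrices, uniformly in the form -/

include hprim in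
/-- **`g(χ)·{∞, γ∞}_{f_χ} = Σ_u χ(u)·{∞, γ'_u∞}_f` with `γ'_u ∈ Γ₀(N)` INDEPENDENT of `f`.**  For
`γ = (a b; c d) ∈ Γ₀(N)` with `c ≠ 0`, Shimura's matrices `γ'_u ∈ SL(2, ℤ)` (same lower-left entry
`c`, `a'/c = a/c + u/p`; tree `exists_sl2_div_eq_div_add_twistShift`) lie in `Γ₀(N)` and
`{∞, a/c + u/p}_f = {∞, γ'_u∞}_f`; combined with the twisting formula
`g(χ){∞, γ∞}_{f_χ} = Σ_u χ(u){∞, a/c + u/p}_f` (tree `gaussSum_mul_cuspSymbol_charTwist`).  For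
`c = 0` both sides vanish (`γ'_u = 1`).  This is the operator identity `T_χ[γ] = Σ_u χ(u)[γ'_u]`
on `H₁(X₀(N), ℤ)` of the seat memo §1 (1a). [cite: Stevens1989, (5.4)–(5.5) p. 97] -/
theorem exists_gaussSum_mul_cuspSymbol_charTwist_eq_sum (γ : Gamma0 N) :
    ∃ γ' : ZMod p → Gamma0 N, ∀ f : CuspForm (Gamma0 N) 2,
      gaussSum χ (ZMod.stdAddChar (N := p)) * cuspSymbol (charTwist N dvd_rfl hpN hχ f) γ =
        ∑ u : ZMod p, χ u * cuspSymbol f (γ' u) := by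
  by_cases hc0 : (γ : SL(2, ℤ)) 1 0 = 0
  · refine ⟨fun _ => 1, fun f => ?_⟩
    rw [cuspSymbol, if_pos hc0, mul_zero]
    simp [cuspSymbol_one]
  · have hsq : ((p : ℤ) ^ 2) ∣ (γ : SL(2, ℤ)) 1 0 := sq_dvd_entry_of_mem_Gamma0 hpN γ.2
    choose g hg10 _hg11 hgdiv using
      fun u : ZMod p => exists_sl2_div_eq_div_add_twistShift (γ : SL(2, ℤ)) hsq hc0 u
    have hmem : ∀ u : ZMod p, g u ∈ Gamma0 N := fun u =>
      mem_Gamma0_of_entry_eq (dvd_refl N) γ.2 (hg10 u)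
    refine ⟨fun u => ⟨g u, hmem u⟩, fun f => ?_⟩
    rw [gaussSum_mul_cuspSymbol_charTwist N dvd_rfl hpN hχ hprim f γ hc0]
    refine Finset.sum_congr rfl fun u _ => ?_
    congr 1
    have hc0' : (g u) 1 0 ≠ 0 := by rw [hg10 u]; exact hc0
    have hcs : cuspSymbol f (⟨g u, hmem u⟩ : Gamma0 N) =
        modularSymbol f ((((g u) 0 0 : ℤ) : ℚ) / (((g u) 1 0 : ℤ) : ℚ)) := by
      unfold cuspSymbol
      exact if_neg hc0'
    rw [hcs, hgdiv u]

/-! ### `T_χ` preserves the period homology -/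

include hprim in
/-- **The twisting operator preserves `H₁(X₀(N), ℤ)`.**  For every `φ` in the period homology
`Λ = periodHomology N` there is `ψ ∈ Λ` with `ψ(f) = g(χ)·φ(f_χ)` for all `f ∈ S₂(Γ₀(N))`: writing
`φ = {∞, γ∞}` (tree `coe_periodHomology_eq_range`), `ψ = Σ_u χ(u)·{∞, γ'_u∞}` with Shimura's
`γ'_u ∈ Γ₀(N)` and `χ(u) ∈ {0, ±1}`.  (`ψ = T_χ φ`; the operator is the transpose of
`f ↦ Σ_u χ(u) f∣[1 u/p; 0 1] = g(χ)f_χ`.) [cite: Stevens1989, Lemma (5.4), proof p. 97] -/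
theorem exists_twist_mem_periodHomology {φ : Module.Dual ℂ (CuspForm (Gamma0 N) 2)}
    (hφ : φ ∈ periodHomology N) :
    ∃ ψ ∈ periodHomology N, ∀ f : CuspForm (Gamma0 N) 2,
      ψ f = gaussSum χ (ZMod.stdAddChar (N := p)) * φ (charTwist N dvd_rfl hpN hχ f) := by
  have hφ' : φ ∈ (periodHomology N : Set (Module.Dual ℂ (CuspForm (Gamma0 N) 2))) := hφ
  rw [coe_periodHomology_eq_range] at hφ'
  obtain ⟨γ, rfl⟩ := hφ'
  obtain ⟨γ', hγ'⟩ := exists_gaussSum_mul_cuspSymbol_charTwist_eq_sum hpN hχ hprim γ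
  refine ⟨∑ u : ZMod p, χ u • periodFunctional N (γ' u), ?_, fun f => ?_⟩
  · exact AddSubgroup.sum_mem _ fun u _ =>
      chi_smul_mem hχ u (AddSubgroup.subset_closure ⟨γ' u, rfl⟩)
  · rw [periodFunctional_apply, hγ' f, LinearMap.sum_apply]
    refine Finset.sum_congr rfl fun u _ => ?_
    rw [LinearMap.smul_apply, periodFunctional_apply, smul_eq_mul]

/-! ### `T_χ² = χ(−1)·p` on the `p`-depleted (new at `p²`) part -/

include hprim in
/-- **The twist is an involution on `p`-depleted forms**: if `aₙ(f) = 0` for all `p ∣ n` (e.g. a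
newform of level `N`, `p² ∣ N`), then `(f_χ)_χ = f` (`q`-expansions: `χ(n)²aₙ = aₙ` for `p ∤ n`).
[cite: Shimura1971, Prop. 3.64] -/
theorem charTwist_charTwist_of_depleted {f : CuspForm (Gamma0 N) 2}
    (hf : ∀ n : ℕ, p ∣ n → cuspCoeff f n = 0) :
    charTwist N dvd_rfl hpN hχ (charTwist N dvd_rfl hpN hχ f) = f := by
  refine eq_of_forall_cuspCoeff_eq_gamma0 fun n ↦ ?_
  rw [cuspCoeff_charTwist N _ hpN hχ hprim, cuspCoeff_charTwist N _ hpN hχ hprim, ← mul_assoc]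
  by_cases hn : p ∣ n
  · rw [hf n hn, mul_zero]
  · have hu : IsUnit ((n : ℕ) : ZMod p) := by
      rw [isUnit_iff_ne_zero, ne_eq, ZMod.natCast_eq_zero_iff]
      exact hn
    rw [← sq, apply_sq_eq_one_of_isQuadratic hχ hu, one_mul]

include hprim in
/-- A primitive character modulo a prime is nontrivial. [folklore] -/
theorem chi_ne_one : χ ≠ 1 := by
  intro h
  have hc := hprim
  rw [DirichletCharacter.IsPrimitive, h, DirichletCharacter.conductor_one] at hc
  exact hp.out.one_lt.ne hc

include hprim in
/-- **`T_χ² = χ(−1)·p` on the `p`-depleted part** (memo §1 (1b)): if `ψ = T_χφ` and `ψ₂ = T_χψ`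
(i.e. `ψ(h) = g(χ)φ(h_χ)`, `ψ₂(h) = g(χ)ψ(h_χ)` for all `h`), then `ψ₂(f) = χ(−1)·p·φ(f)` for every
`p`-depleted `f` — from `(f_χ)_χ = f` and `g(χ)² = χ(−1)p` (Mathlib `gaussSum_sq`).  The finite shadow is
`TwistOperatorFiniteModel.sum_smul_sum_smul_apply_add_add` (`T_χ² = χ(−1)(q − U)`).
[cite: Shimura1971, Prop. 3.64] -/
theorem twist_twist_apply_of_depleted {φ ψ ψ₂ : Module.Dual ℂ (CuspForm (Gamma0 N) 2)}
    (hψ : ∀ h, ψ h = gaussSum χ (ZMod.stdAddChar (N := p)) * φ (charTwist N dvd_rfl hpN hχ h))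
    (hψ₂ : ∀ h, ψ₂ h = gaussSum χ (ZMod.stdAddChar (N := p)) * ψ (charTwist N dvd_rfl hpN hχ h))
    {f : CuspForm (Gamma0 N) 2} (hf : ∀ n : ℕ, p ∣ n → cuspCoeff f n = 0) :
    ψ₂ f = χ (-1) * p * φ f := by
  rw [hψ₂, hψ, charTwist_charTwist_of_depleted hpN hχ hprim hf, ← mul_assoc, ← sq,
    gaussSum_sq (chi_ne_one hprim) hχ (ZMod.isPrimitive_stdAddChar p), ZMod.card]

/-! ### `T_χ` twists Hecke eigenvalues -/

include hprim in
/-- **`T_χ` carries the `f_χ`-eigensystem to the `f`-eigensystem** (memo §1 (1c)): for a prime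
`ℓ ≠ p`, if `φ` is a `T_ℓ^∨`-eigenvector with eigenvalue `a` (`φ(T_ℓh) = aφ(h)` for all `h`) and
`ψ = T_χφ`, then `ψ(T_ℓ h) = χ(ℓ)a·ψ(h)` — because `T_ℓ(h_χ) = χ(ℓ)(T_ℓh)_χ` (tree `heckeT_charTwist`)
and `χ(ℓ)² = 1`.  Hence `T_χ` maps the `f⊗χ`-isotypic sublattice `S_{f⊗χ}` of `H₁(X₀(N), ℤ)` into
`S_f` and conversely. [cite: Shimura1971, Prop. 3.64] -/
theorem twist_apply_heckeT_of_eigen {φ ψ : Module.Dual ℂ (CuspForm (Gamma0 N) 2)}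
    (hψ : ∀ h, ψ h = gaussSum χ (ZMod.stdAddChar (N := p)) * φ (charTwist N dvd_rfl hpN hχ h))
    {ℓ : ℕ} [NeZero ℓ] (hℓ : ℓ.Prime) (hℓp : ℓ ≠ p) {a : ℂ}
    (hφ : ∀ h, φ (heckeT (Gamma0 N) 2 ℓ h) = a * φ h) (h : CuspForm (Gamma0 N) 2) :
    ψ (heckeT (Gamma0 N) 2 ℓ h) = χ (ℓ : ZMod p) * a * ψ h := by
  have hℓp' : ¬ ℓ ∣ p := fun hd =>
    hℓp ((Nat.prime_dvd_prime_iff_eq hℓ hp.out).mp hd)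
  have hsq : χ (ℓ : ZMod p) * χ (ℓ : ZMod p) = 1 := by
    rw [← sq]
    exact apply_sq_eq_one_of_isQuadratic hχ ((ZMod.isUnit_prime_iff_not_dvd hℓ).2 hℓp')
  -- `(T_ℓ h)_χ = χ(ℓ) • T_ℓ (h_χ)`
  have htw : charTwist N dvd_rfl hpN hχ (heckeT (Gamma0 N) 2 ℓ h) =
      χ (ℓ : ZMod p) • heckeT (Gamma0 N) 2 ℓ (charTwist N dvd_rfl hpN hχ h) := by
    rw [heckeT_charTwist N dvd_rfl hpN hχ hprim h hℓ hℓp' Iff.rfl, smul_smul, hsq, one_smul]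
  rw [hψ, htw, map_smul, smul_eq_mul, hφ, hψ]
  ring

/-! ### Reading on period lattices -/

/-- **`Per_f(T_χφ) = g(χ)·Per_{f_χ}(φ)`**: evaluating `ψ = T_χφ` at `f` gives `g(χ)` times the
`f_χ`-period of `φ`.  With `φ` ranging over `Λ = H₁(X₀(N), ℤ)` this says `Per_f(T_χΛ) = g(χ)·Λ(f_χ)`,
i.e. `T_χ` realises the inclusion `g(χ)Λ(f_χ) ⊆ Λ(f)` (tree
`gaussSum_mul_mem_periodLattice_of_mem_charTwist`) whose equality is the crux K; the index
`[Λ(f) : g(χ)Λ(f_χ)]` is the index of `T_χ(Λ)` in `Λ` modulo the kernel of `Per_f`.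
[cite: Stevens1989, Lemma (5.4) p. 97] -/
theorem gaussSum_mul_mem_map_of_twist {φ ψ : Module.Dual ℂ (CuspForm (Gamma0 N) 2)}
    (hψ : ∀ h, ψ h = gaussSum χ (ZMod.stdAddChar (N := p)) * φ (charTwist N dvd_rfl hpN hχ h))
    (hψΛ : ψ ∈ periodHomology N) (f : CuspForm (Gamma0 N) 2) :
    gaussSum χ (ZMod.stdAddChar (N := p)) * φ (charTwist N dvd_rfl hpN hχ f) ∈
      (periodHomology N).map (LinearMap.applyₗ (R := ℂ) f).toAddMonoidHom := by
  rw [← hψ f]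
  exact ⟨ψ, hψΛ, rfl⟩

end Summit.BirchSwinnertonDyer.BirchSwinnertonDyer.Theorems.TeichmullerTwistDescent.TwistOperatorPeriodHomology

end
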